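import Summits.QuantumFields.YangMills.Theorems.BalabanUVNodesN15BackgroundSiteByName
import Summits.QuantumFields.YangMills.Theorems.BalabanUVNodesN15VectorPieceVWordsCoarse
import HarnessLib

/-!
# Route «BalabanUVNodes» (K4 «SpineRates»), node N15 = NE2 — THE SITE-KERNEL LAYER WITH THE BACKGROUND LIVE, VI: `T4EtaRate.NE2PlusSite` BY NAME FOR THE U = 1
# VECTOR PIECE ⊗ 1_𝔤 — the dressed site kernel `[Q′(U′U)G′²(U′U)Q′*(U′U)]⁻¹` over the SAME paired instances `v1GVecInstance` as F16's operator layer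
# `ne2PlusOperator_vectorPiece_vWordsGC` ((3.60)-shaped full perturbation, gauge field the datum, King's pairing), every `U ≡ 1` OPERATOR input a landed theorem,
# the `U ≡ 1` SITE KERNELS displayed

Cell `pub-ymgap`, seat `pub-ymgap-dag-n15-c` (generation g5; R134 ACCELERATION SEAT, strategy s1; HUMAN RULING D-0062; chair R424 venue; `bears_on: R4∕N15`).  Filed
`--supports stmt-QuantumFields-20292 --as helper` (K3⁗; count-neutral).  Imports this seat's S5 `…N15BackgroundSiteByName` (`ne2PlusSite_vWGC`, `vWGCSiteKernel`) and g4's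
F16 `…N15VectorPieceVWordsCoarse` (the vector-piece data: `unitTorusGeoS`, `blkFine`, `kingPrV`, `qbond`, `card_fibre_kingPrV_lift`, `vecWordC`∕`vecWordF`, `vecWord_letters`,
`uniform_layer_v1M`, `kingPrV_bshiftEquiv_pow`, `bshiftEquiv_comm`, `fibre_conn_kingPrV`, `thetaV`, `inv_pow_le_rpow`) BY NAME; nothing in the tree is modified.

WHAT THIS FILE IS.  `vWGCVecSiteKernel` = S5's site-kernel family fed with exactly the data of F16's `vWGCVecFamily4` (the -a pieces ⊗ 1_𝔤: `G = tensorId ι pieceG`, derived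
`dPieces` on the forward∕backward stack, at both spacings; King's bond pairing lifted to the product carrier; the unit-bond site lattice `(Tor M × Fin (d+1)) × ι` with the
componentwise block mean over `qbond`; word species `vecWordC`∕`vecWordF` of a given averaging species) plus the averaging species themselves and the `U ≡ 1` site
kernels `Ws j, Ws′ j`.  ★★ **`ne2PlusSite_vectorPiece_vWordsGC`**: `NE2PlusSite 4 p c₃₅ (v1GVecInstance …) (vWGCVecSiteKernel …)` for `d + 1 ≥ 2`, `L ≥ 1`, `c₃₅ > 0`, ANY
averaging species with the six (3.35)-letters (`c_F ≥ 0`, as in F16), and ANY `U ≡ 1` site kernels with a uniform decaying majorant inverting `QG²Q*` ∕ `Q′G′²Q′*` — every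
other input (the `U ≡ 1` operator layer, uniform fibres, the block-translation law, fibre connectivity) a LANDED theorem of n15-a∕-c.  `_dim4` corollary.

HONEST FRAMING ∕ LIMITS.  LINEAR (`U ≡ 1`) vector single-scale piece of [B5]∕[B6]∕King (4.42) tensored with `1_𝔤`, dressed by the (3.60)-shaped `V′(A′)`; the `U ≡ 1` SITE
KERNELS (inverse of `QG²Q*` for that piece, with decay — a [B5]∕King-type object, -a∕-e turf) are DISPLAYED hypotheses, as are the averaging species' letters (g4 F7∕F9
construct the print's one-level species); transport of configurations = fibrewise mean; one-level contour; NE2⁺ NOT PRINTED, NOT proved for Bałaban's `G(U)`;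
count-neutral (typed 28∕28; discharged count unchanged); N15 NOT discharged; one finite T⁴ at fixed ε — NOT ℝ⁴, NOT infinite volume, NOT OS, NOT a mass gap, NOT Clay.
-/

noncomputable section

open scoped BigOperators
open Finset

namespace Summit.QuantumFields.YangMills.BalabanUVNodes.N15.VectorPiece

open Literature.MathematicalPhysics.QuantumFieldTheory.Balaban1983to89
open Literature.MathematicalPhysics.QuantumFieldTheory.Balaban1983to89.B11SectG (BlockNorm HasMaj RowSum)
open Literature.MathematicalPhysics.QuantumFieldTheory.Balaban1983to89.B6RandomWalk (Triangle254)
open Literature.MathematicalPhysics.QuantumFieldTheory.Balaban1983to89.T4EtaRate (PairedInstance NE2PlusSite)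
open Literature.MathematicalPhysics.QuantumFieldTheory.Balaban1983to89.T4EtaRateDefect (idef rateWeight)
open Literature.MathematicalPhysics.QuantumFieldTheory.Balaban1983to89.T4EtaRateCoeffDefect (pull diagK fibre)
open Literature.MathematicalPhysics.QuantumFieldTheory.Balaban1983to89.B5Prop11Plancherel (Tor fine unitVec)
open Literature.MathematicalPhysics.QuantumFieldTheory.Balaban1983to89.B6UnitTorusCarrier (unitTorusGeo unitTorusGeo_len triangle254_unitTorusGeo
  rowSum_unitTorusGeo)
open Literature.MathematicalPhysics.QuantumFieldTheory.King1986.Torus (tdistT tdistT_nonneg)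
open Summit.QuantumFields.YangMills.BalabanUVNodes.N15.MatrixSpecies (liftMap liftBlk basisConst_nonneg)
open Summit.QuantumFields.YangMills.BalabanUVNodes.N15.SiteLayer (siteForm₀ vWGCSiteKernel ne2PlusSite_vWGC hasMaj_exp_mono)

variable {d : ℕ}

section Knit

variable (𝔄 : Type) [NormedRing 𝔄] [NormedAlgebra ℝ 𝔄] [CompleteSpace 𝔄] (ι : Type) [Fintype ι] [DecidableEq ι] (e : 𝔄 ≃L[ℝ] (ι → ℝ)) (L : ℕ) [NeZero L]
  (a : ℝ)

/-- THE REALISED SITE-KERNEL FAMILY AT THE VECTOR PIECE ⊗ 1_𝔤: S5's `vWGCSiteKernel` fed with F16's data (the -a pieces `G`, `dPieces` at both spacings, King's pairing,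
word species `vecWordC`∕`vecWordF`), the averaging species `Fc, Fsc, Ff, Fsf`, the unit-bond site lattice blocked by the bond's base point, and the `U ≡ 1` site
kernels `Ws j` (coarse), `Ws′ j` (fine). [cite: Balaban1985BackgroundPropagators, Thm 3.2 (3.48) p.398, (3.65)–(3.67) p.403 (shapes)] -/
def vWGCVecSiteKernel (hL : 1 ≤ L)
    (Fc : ∀ j : VecIndexS d L, (Fin (d + 1) → Tor (fine (L ^ j.m * L ^ j.k) j.Mn) × Fin (d + 1) → 𝔄) →
      (((Tor (fine (L ^ j.k) j.Mn) × Fin (d + 1)) × ι → ℝ) →ₗ[ℝ] ((Tor j.Mn × Fin (d + 1)) × ι → ℝ)))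
    (Fsc : ∀ j : VecIndexS d L, (Fin (d + 1) → Tor (fine (L ^ j.m * L ^ j.k) j.Mn) × Fin (d + 1) → 𝔄) →
      (((Tor j.Mn × Fin (d + 1)) × ι → ℝ) →ₗ[ℝ] ((Tor (fine (L ^ j.k) j.Mn) × Fin (d + 1)) × ι → ℝ)))
    (Ff : ∀ j : VecIndexS d L, (Fin (d + 1) → Tor (fine (L ^ j.m * L ^ j.k) j.Mn) × Fin (d + 1) → 𝔄) →
      (((Tor (fine (L ^ j.m * L ^ j.k) j.Mn) × Fin (d + 1)) × ι → ℝ) →ₗ[ℝ] ((Tor j.Mn × Fin (d + 1)) × ι → ℝ)))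
    (Fsf : ∀ j : VecIndexS d L, (Fin (d + 1) → Tor (fine (L ^ j.m * L ^ j.k) j.Mn) × Fin (d + 1) → 𝔄) →
      (((Tor j.Mn × Fin (d + 1)) × ι → ℝ) →ₗ[ℝ] ((Tor (fine (L ^ j.m * L ^ j.k) j.Mn) × Fin (d + 1)) × ι → ℝ)))
    (Ws Ws' : ∀ j : VecIndexS d L, ((Tor j.Mn × Fin (d + 1)) × ι → ℝ) →ₗ[ℝ] ((Tor j.Mn × Fin (d + 1)) × ι → ℝ)) (j : VecIndexS d L) :
    B9.SiteKernel (v1GVecInstance (d := d) 𝔄 ι L hL j).gc (v1GVecInstance (d := d) 𝔄 ι L hL j).Bf :=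
  vWGCSiteKernel e (fun j : VecIndexS d L => unitTorusGeoS L j.k j.Mn j.Msz) (fun j => Tor (fine (L ^ j.k) j.Mn) × Fin (d + 1))
    (fun j => Tor (fine (L ^ j.m * L ^ j.k) j.Mn) × Fin (d + 1)) (fun j => (Tor j.Mn × Fin (d + 1)) × ι) (fun j => blkFine L j.k j.Mn)
    (fun j => liftBlk (fun b : Tor j.Mn × Fin (d + 1) => b.1) ι) (fun j => liftMap (qbond L j.k j.Mn) ι) (fun j => kingPrV L j.k j.m j.Mn) (fun j => j.m)
    (fun j => unitTorusGeoS_L_ne_zero L hL j)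
    (fun j => tensorId ι (pieceG L j.Mn (L ^ j.k) j.k (rweight (d := d) L j.k)))
    (fun j μ => tensorId ι (dPieces L j.Mn (L ^ j.k) j.k (rweight (d := d) L j.k) μ))
    (fun j => tensorId ι (pieceG L j.Mn (L ^ j.m * L ^ j.k) (j.k + j.m) (rweight (d := d) L j.k / ((L : ℝ) ^ j.m) ^ (d + 1))))
    (fun j μ => tensorId ι (dPieces L j.Mn (L ^ j.m * L ^ j.k) (j.k + j.m) (rweight (d := d) L j.k / ((L : ℝ) ^ j.m) ^ (d + 1)) μ))
    (fun j κ => bshiftEquiv j.Mn (L ^ j.k) κ) (fun j κ => bshiftEquiv j.Mn (L ^ j.m * L ^ j.k) κ)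
    (fun j => vecWordC ι L a j (Fc j) (Fsc j)) (fun j => vecWordF ι L a j (Ff j) (Fsf j)) Fc Fsc Ff Fsf Ws Ws' j

variable {𝔄 ι L}

/-- **NE2⁺, SITE-KERNEL LAYER — `T4EtaRate.NE2PlusSite 4 p c₃₅` BY NAME FOR THE U = 1 VECTOR PIECE ⊗ 1_𝔤 DRESSED BY THE (3.60)-SHAPED FULL PERTURBATION, GAUGE FIELD THE
DATUM** — on F16's paired instances `v1GVecInstance`, for ANY averaging species with the six letters (`c_F ≥ 0`, F16's hypothesis `hF` verbatim) and ANY `U ≡ 1` site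
kernels `Ws j, Ws′ j` on the unit-bond site lattice with a uniform majorant `β_W·e^{−δ_W d}` inverting `Q(G ⊗ 1)²Q*` ∕ `Q′(G′ ⊗ 1)²Q′*`; every `U ≡ 1` operator input a landed
theorem (`uniform_layer_v1M`, `card_fibre_kingPrV_lift`, `kingPrV_bshiftEquiv_pow`, `fibre_conn_kingPrV`).  Inside: `ne2PlusSite_vWGC` at the rate `min(δ, δ_W)`,
`σ = min(δ, δ_W)∕10`, `c_W = |a|c_F(2 + c_F)`. [cite: Balaban1985BackgroundPropagators, Thm 3.2 (3.48) p.398 + Thm 3.14 pp.426–427 (quantifier template), (3.35)–(3.36) p.396, (3.60) p.402, (3.65)–(3.67) p.403 (shapes, mechanism); King1986, (4.42)–(4.43) p.675, p.664] -/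
theorem ne2PlusSite_vectorPiece_vWordsGC (hd : 1 ≤ d) (hL : 1 ≤ L) (c35 : ℝ) (hc35 : 0 < c35) (p : ℝ) {cF : ℝ} (hcF : 0 ≤ cF)
    (Fc : ∀ j : VecIndexS d L, (Fin (d + 1) → Tor (fine (L ^ j.m * L ^ j.k) j.Mn) × Fin (d + 1) → 𝔄) →
      (((Tor (fine (L ^ j.k) j.Mn) × Fin (d + 1)) × ι → ℝ) →ₗ[ℝ] ((Tor j.Mn × Fin (d + 1)) × ι → ℝ)))
    (Fsc : ∀ j : VecIndexS d L, (Fin (d + 1) → Tor (fine (L ^ j.m * L ^ j.k) j.Mn) × Fin (d + 1) → 𝔄) →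
      (((Tor j.Mn × Fin (d + 1)) × ι → ℝ) →ₗ[ℝ] ((Tor (fine (L ^ j.k) j.Mn) × Fin (d + 1)) × ι → ℝ)))
    (Ff : ∀ j : VecIndexS d L, (Fin (d + 1) → Tor (fine (L ^ j.m * L ^ j.k) j.Mn) × Fin (d + 1) → 𝔄) →
      (((Tor (fine (L ^ j.m * L ^ j.k) j.Mn) × Fin (d + 1)) × ι → ℝ) →ₗ[ℝ] ((Tor j.Mn × Fin (d + 1)) × ι → ℝ)))
    (Fsf : ∀ j : VecIndexS d L, (Fin (d + 1) → Tor (fine (L ^ j.m * L ^ j.k) j.Mn) × Fin (d + 1) → 𝔄) →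
      (((Tor j.Mn × Fin (d + 1)) × ι → ℝ) →ₗ[ℝ] ((Tor (fine (L ^ j.m * L ^ j.k) j.Mn) × Fin (d + 1)) × ι → ℝ)))
    (hF : ∀ (j : VecIndexS d L) (α₀ : ℝ) A', 0 < α₀ → 2 * (c35 * (j.Msz * α₀)) ≤ 1 → (v1GVecInstance (d := d) 𝔄 ι L hL j).Bf.Reg335 c35 α₀ A' →
      HasMaj (BlockNorm.ofBlocks (unitTorusGeoS L j.k j.Mn j.Msz) (liftBlk (blkFine L j.k j.Mn) ι))
        (BlockNorm.ofBlocks (unitTorusGeoS L j.k j.Mn j.Msz) (liftBlk (fun b : Tor j.Mn × Fin (d + 1) => b.1) ι)) (Fc j A')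
        (diagK fun _ => cF * (c35 * j.Msz * α₀)) ∧
      HasMaj (BlockNorm.ofBlocks (unitTorusGeoS L j.k j.Mn j.Msz) (liftBlk (fun b : Tor j.Mn × Fin (d + 1) => b.1) ι))
        (BlockNorm.ofBlocks (unitTorusGeoS L j.k j.Mn j.Msz) (liftBlk (blkFine L j.k j.Mn) ι)) (Fsc j A') (diagK fun _ => cF * (c35 * j.Msz * α₀)) ∧
      HasMaj (BlockNorm.ofBlocks (unitTorusGeoS L j.k j.Mn j.Msz) (liftBlk (blkFine L j.k j.Mn ∘ kingPrV L j.k j.m j.Mn) ι))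
        (BlockNorm.ofBlocks (unitTorusGeoS L j.k j.Mn j.Msz) (liftBlk (fun b : Tor j.Mn × Fin (d + 1) => b.1) ι)) (Ff j A')
        (diagK fun _ => cF * (c35 * j.Msz * α₀)) ∧
      HasMaj (BlockNorm.ofBlocks (unitTorusGeoS L j.k j.Mn j.Msz) (liftBlk (fun b : Tor j.Mn × Fin (d + 1) => b.1) ι))
        (BlockNorm.ofBlocks (unitTorusGeoS L j.k j.Mn j.Msz) (liftBlk (blkFine L j.k j.Mn ∘ kingPrV L j.k j.m j.Mn) ι)) (Fsf j A')
        (diagK fun _ => cF * (c35 * j.Msz * α₀)) ∧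
      HasMaj (BlockNorm.ofBlocks (unitTorusGeoS L j.k j.Mn j.Msz) (liftBlk (blkFine L j.k j.Mn) ι))
        (BlockNorm.ofBlocks (unitTorusGeoS L j.k j.Mn j.Msz) (liftBlk (fun b : Tor j.Mn × Fin (d + 1) => b.1) ι))
        (idef (pull (liftMap (kingPrV L j.k j.m j.Mn) ι)) LinearMap.id (Ff j A') (Fc j A')) (diagK fun _ => cF * (c35 * j.Msz * α₀) * thetaV L j) ∧
      HasMaj (BlockNorm.ofBlocks (unitTorusGeoS L j.k j.Mn j.Msz) (liftBlk (fun b : Tor j.Mn × Fin (d + 1) => b.1) ι))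
        (BlockNorm.ofBlocks (unitTorusGeoS L j.k j.Mn j.Msz) (liftBlk (blkFine L j.k j.Mn ∘ kingPrV L j.k j.m j.Mn) ι))
        (idef LinearMap.id (pull (liftMap (kingPrV L j.k j.m j.Mn) ι)) (Fsf j A') (Fsc j A')) (diagK fun _ => cF * (c35 * j.Msz * α₀) * thetaV L j))
    (Ws Ws' : ∀ j : VecIndexS d L, ((Tor j.Mn × Fin (d + 1)) × ι → ℝ) →ₗ[ℝ] ((Tor j.Mn × Fin (d + 1)) × ι → ℝ)) {βW δW : ℝ} (hβW : 0 ≤ βW) (hδW : 0 < δW)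
    (hWs : ∀ j, HasMaj (BlockNorm.ofBlocks (unitTorusGeoS L j.k j.Mn j.Msz) (liftBlk (fun b : Tor j.Mn × Fin (d + 1) => b.1) ι))
      (BlockNorm.ofBlocks (unitTorusGeoS L j.k j.Mn j.Msz) (liftBlk (fun b : Tor j.Mn × Fin (d + 1) => b.1) ι)) (Ws j)
      (fun y y' => βW * Real.exp (-(δW * (unitTorusGeoS L j.k j.Mn j.Msz).dist y y'))))
    (hWs' : ∀ j, HasMaj (BlockNorm.ofBlocks (unitTorusGeoS L j.k j.Mn j.Msz) (liftBlk (fun b : Tor j.Mn × Fin (d + 1) => b.1) ι))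
      (BlockNorm.ofBlocks (unitTorusGeoS L j.k j.Mn j.Msz) (liftBlk (fun b : Tor j.Mn × Fin (d + 1) => b.1) ι)) (Ws' j)
      (fun y y' => βW * Real.exp (-(δW * (unitTorusGeoS L j.k j.Mn j.Msz).dist y y'))))
    (hKW : ∀ j, siteForm₀ (liftMap (qbond L j.k j.Mn) ι) (tensorId ι (pieceG L j.Mn (L ^ j.k) j.k (rweight (d := d) L j.k))) ∘ₗ Ws j = LinearMap.id)
    (hKW' : ∀ j, siteForm₀ (liftMap (qbond L j.k j.Mn) ι ∘ liftMap (kingPrV L j.k j.m j.Mn) ι)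
      (tensorId ι (pieceG L j.Mn (L ^ j.m * L ^ j.k) (j.k + j.m) (rweight (d := d) L j.k / ((L : ℝ) ^ j.m) ^ (d + 1)))) ∘ₗ Ws' j = LinearMap.id) :
    NE2PlusSite 4 p c35 (v1GVecInstance (d := d) 𝔄 ι L hL) (vWGCVecSiteKernel (d := d) 𝔄 ι e L a hL Fc Fsc Ff Fsf Ws Ws') := by
  obtain ⟨β, δ₁, m₀, hβ, hδ₁, hm₀, H⟩ := uniform_layer_v1M (d := d) (ι := ι) (L := L) hd hL
  have hL0 : L ≠ 0 := by omega
  have hLr : (0 : ℝ) < (L : ℝ) := by exact_mod_cast (show 0 < L by omega)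
  have hL1 : (1 : ℝ) ≤ (L : ℝ) := by exact_mod_cast hL
  -- the common rate of the `U ≡ 1` operator layer and the `U ≡ 1` site kernels
  set δ : ℝ := min δ₁ δW with hδdef
  have hδ : 0 < δ := lt_min hδ₁ hδW
  have hδδ₁ : δ ≤ δ₁ := min_le_left _ _
  have hδδW : δ ≤ δW := min_le_right _ _
  have hσ : 0 < δ / 10 := by positivity
  have hd1 : (0 : ℝ) ≤ 2 * ((d : ℝ) + 1) := by positivity
  have hcW : 0 ≤ |a| * cF * (2 + cF) := by positivity
  have hdist : ∀ (j : VecIndexS d L) (y y' : (unitTorusGeoS L j.k j.Mn j.Msz).Site), 0 ≤ (unitTorusGeoS L j.k j.Mn j.Msz).dist y y' :=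
    fun j y y' => tdistT_nonneg _ _ _
  have hθ0 : ∀ j : VecIndexS d L, 0 ≤ thetaV L j := fun j => by unfold thetaV; positivity
  -- `C_π(j)·η′_j ≤ 2(d+1)·θ_j` (F16)
  have hCθ : ∀ j : VecIndexS d L, ((2 * ((d + 1) * (L ^ j.m - 1)) : ℕ) : ℝ) *
      ((unitTorusGeoS L j.k j.Mn j.Msz).eta * ((unitTorusGeoS L j.k j.Mn j.Msz).L ^ j.m)⁻¹) ≤ 2 * ((d : ℝ) + 1) * thetaV L j := by
    intro j
    have hLm : (0 : ℝ) < (L : ℝ) ^ j.m := pow_pos hLr _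
    have hLk : (0 : ℝ) < (L : ℝ) ^ j.k := pow_pos hLr _
    have hθ : ((L : ℝ) ^ j.k)⁻¹ ≤ thetaV L j := inv_pow_le_rpow hL j.k (by norm_num)
    have hsub : (((L ^ j.m - 1 : ℕ)) : ℝ) ≤ (L : ℝ) ^ j.m := by
      have h1 : 1 ≤ L ^ j.m := Nat.one_le_pow _ _ (by omega)
      rw [Nat.cast_sub h1]; push_cast; linarith
    show ((2 * ((d + 1) * (L ^ j.m - 1)) : ℕ) : ℝ) * (((L : ℝ) ^ j.k)⁻¹ * ((L : ℝ) ^ j.m)⁻¹) ≤ 2 * ((d : ℝ) + 1) * thetaV L j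
    have hcast : ((2 * ((d + 1) * (L ^ j.m - 1)) : ℕ) : ℝ) = 2 * ((d : ℝ) + 1) * (((L ^ j.m - 1 : ℕ)) : ℝ) := by push_cast; ring
    rw [hcast]
    calc 2 * ((d : ℝ) + 1) * (((L ^ j.m - 1 : ℕ)) : ℝ) * (((L : ℝ) ^ j.k)⁻¹ * ((L : ℝ) ^ j.m)⁻¹)
        ≤ 2 * ((d : ℝ) + 1) * (L : ℝ) ^ j.m * (((L : ℝ) ^ j.k)⁻¹ * ((L : ℝ) ^ j.m)⁻¹) :=
          mul_le_mul_of_nonneg_right (mul_le_mul_of_nonneg_left hsub hd1) (by positivity)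
      _ = 2 * ((d : ℝ) + 1) * ((L : ℝ) ^ j.k)⁻¹ := by field_simp
      _ ≤ 2 * ((d : ℝ) + 1) * thetaV L j := mul_le_mul_of_nonneg_left hθ hd1
  -- the word letters from the species letters (F4 `vecWord_letters`)
  have hW := fun (j : VecIndexS d L) (α₀ : ℝ) (A' : Fin (d + 1) → Tor (fine (L ^ j.m * L ^ j.k) j.Mn) × Fin (d + 1) → 𝔄) (hα₀ : 0 < α₀)
      (hsm : 2 * (c35 * (j.Msz * α₀)) ≤ 1) (hreg : (v1GVecInstance (d := d) 𝔄 ι L hL j).Bf.Reg335 c35 α₀ A') =>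
    vecWord_letters ι L a j hc35 hα₀ hcF hsm (hF j α₀ A' hα₀ hsm hreg).1 (hF j α₀ A' hα₀ hsm hreg).2.1 (hF j α₀ A' hα₀ hsm hreg).2.2.1
      (hF j α₀ A' hα₀ hsm hreg).2.2.2.1 (hF j α₀ A' hα₀ hsm hreg).2.2.2.2.1 (hF j α₀ A' hα₀ hsm hreg).2.2.2.2.2
  -- the block-translation law of King's pairing and `η = L^m·η′` (F16)
  have hblk : ∀ (j : VecIndexS d L) (μ : Fin (d + 1)) (x' : Tor (fine (L ^ j.m * L ^ j.k) j.Mn) × Fin (d + 1)),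
      kingPrV L j.k j.m j.Mn ((bshiftEquiv j.Mn (L ^ j.m * L ^ j.k) μ ^ (L ^ j.m)) x') =
        bshiftEquiv j.Mn (L ^ j.k) μ (kingPrV L j.k j.m j.Mn x') := fun j μ x' => kingPrV_bshiftEquiv_pow L j.k j.m j.Mn μ x'
  have hN : ∀ j : VecIndexS d L, (unitTorusGeoS L j.k j.Mn j.Msz).eta =
      ((L ^ j.m : ℕ) : ℝ) * ((unitTorusGeoS L j.k j.Mn j.Msz).eta * ((unitTorusGeoS L j.k j.Mn j.Msz).L ^ j.m)⁻¹) := by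
    intro j
    show ((L : ℝ) ^ j.k)⁻¹ = ((L ^ j.m : ℕ) : ℝ) * (((L : ℝ) ^ j.k)⁻¹ * ((L : ℝ) ^ j.m)⁻¹)
    have hLm : (0 : ℝ) < (L : ℝ) ^ j.m := pow_pos hLr _
    push_cast
    field_simp
  -- the `U ≡ 1` letters at the common rate
  have hme : ∀ j : VecIndexS d L, 0 ≤ m₀ * thetaV L j := fun j => mul_nonneg hm₀.le (hθ0 j)
  exact ne2PlusSite_vWGC e (I := VecIndexS d L) (J := Fin (d + 1)) (fun j => unitTorusGeoS L j.k j.Mn j.Msz)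
    (fun j => Tor (fine (L ^ j.k) j.Mn) × Fin (d + 1)) (fun j => Tor (fine (L ^ j.m * L ^ j.k) j.Mn) × Fin (d + 1)) (fun j => (Tor j.Mn × Fin (d + 1)) × ι)
    (fun j => blkFine L j.k j.Mn) (fun j => liftBlk (fun b : Tor j.Mn × Fin (d + 1) => b.1) ι) (fun j => liftMap (qbond L j.k j.Mn) ι)
    (fun j => kingPrV L j.k j.m j.Mn) (fun j => j.m) (fun j => unitTorusGeoS_L_ne_zero L hL j) (thetaV L)
    (fun j => tensorId ι (pieceG L j.Mn (L ^ j.k) j.k (rweight (d := d) L j.k)))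
    (fun j μ => tensorId ι (dPieces L j.Mn (L ^ j.k) j.k (rweight (d := d) L j.k) μ))
    (fun j => tensorId ι (pieceG L j.Mn (L ^ j.m * L ^ j.k) (j.k + j.m) (rweight (d := d) L j.k / ((L : ℝ) ^ j.m) ^ (d + 1))))
    (fun j μ => tensorId ι (dPieces L j.Mn (L ^ j.m * L ^ j.k) (j.k + j.m) (rweight (d := d) L j.k / ((L : ℝ) ^ j.m) ^ (d + 1)) μ))
    (fun j κ => bshiftEquiv j.Mn (L ^ j.k) κ) (fun j κ => bshiftEquiv j.Mn (L ^ j.m * L ^ j.k) κ) (fun j => ((2 * ((d + 1) * (L ^ j.m - 1)) : ℕ) : ℝ))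
    (fun j => L ^ j.m) (fun j => (L ^ j.m) ^ (d + 1))
    (fun j => vecWordC ι L a j (Fc j) (Fsc j)) (fun j => vecWordF ι L a j (Ff j) (Fsf j)) Fc Fsc Ff Fsf Ws Ws' c35 hc35 p
    (fun j => triangle254_unitTorusGeo L j.k j.Mn) hdist hσ.le
    (B4Sect5Proof.latticeConst_nonneg (d + 1) hσ.le) (fun j => rowSum_unitTorusGeo L j.k j.Mn hσ)
    (fun j => inv_pos.mpr (pow_pos hLr _)) (fun j => inv_le_one_of_one_le₀ (one_le_pow₀ hL1)) (fun j => inv_pow_le_rpow hL j.k (by norm_num))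
    (fun j => hL1) (fun j y => unitTorusGeo_len L j.k j.Mn hL0 y)
    (by linarith) hβ.le hm₀.le (by norm_num : (0 : ℝ) < 1 / 4) (fun j y => le_rfl)
    (fun j μ κ x => bshiftEquiv_comm j.Mn (L ^ j.m * L ^ j.k) μ κ x) (fun j => Nat.cast_nonneg _)
    (fun j f b hf => fibre_conn_kingPrV L j.k j.m j.Mn f b hf) hd1 hCθ hcW hcF hβW hblk hN
    (fun j pt => rfl) (fun j => pow_ne_zero _ (pow_ne_zero _ (NeZero.ne L))) (fun j => card_fibre_kingPrV_lift L j.k j.m j.Mn ι)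
    (fun j α₀ A' hα₀ hsm hreg => (hW j α₀ A' hα₀ hsm hreg).1) (fun j α₀ A' hα₀ hsm hreg => (hW j α₀ A' hα₀ hsm hreg).2.1)
    (fun j α₀ A' hα₀ hsm hreg => (hW j α₀ A' hα₀ hsm hreg).2.2)
    (fun j α₀ A' hα₀ hsm hreg => (hF j α₀ A' hα₀ hsm hreg).1) (fun j α₀ A' hα₀ hsm hreg => (hF j α₀ A' hα₀ hsm hreg).2.1)
    (fun j α₀ A' hα₀ hsm hreg => (hF j α₀ A' hα₀ hsm hreg).2.2.1) (fun j α₀ A' hα₀ hsm hreg => (hF j α₀ A' hα₀ hsm hreg).2.2.2.1)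
    (fun j α₀ A' hα₀ hsm hreg => (hF j α₀ A' hα₀ hsm hreg).2.2.2.2.1) (fun j α₀ A' hα₀ hsm hreg => (hF j α₀ A' hα₀ hsm hreg).2.2.2.2.2)
    (fun j => hasMaj_exp_mono (hdist j) hβ.le hδδ₁ (H j).1) (fun j μ => hasMaj_exp_mono (hdist j) hβ.le hδδ₁ ((H j).2.1 μ))
    (fun j => hasMaj_exp_mono (hdist j) hβ.le hδδ₁ (H j).2.2.1) (fun j μ => hasMaj_exp_mono (hdist j) hβ.le hδδ₁ ((H j).2.2.2.1 μ))
    (fun j => hasMaj_exp_mono (hdist j) (hme j) hδδ₁ (H j).2.2.2.2.2.2.2.1)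
    (fun j μ => hasMaj_exp_mono (hdist j) (hme j) hδδ₁ ((H j).2.2.2.2.2.2.2.2.1 μ))
    (fun j => hasMaj_exp_mono (hdist j) hβW hδδW (hWs j)) (fun j => hasMaj_exp_mono (hdist j) hβW hδδW (hWs' j)) hKW hKW'

/-- The four-torus specialisation (`d + 1 = 4`, `L ≥ 1`). [folklore] -/
theorem ne2PlusSite_vectorPiece_vWordsGC_dim4 (hL : 1 ≤ L) (c35 : ℝ) (hc35 : 0 < c35) (p : ℝ) {cF : ℝ} (hcF : 0 ≤ cF)
    (Fc : ∀ j : VecIndexS 3 L, (Fin 4 → Tor (fine (L ^ j.m * L ^ j.k) j.Mn) × Fin 4 → 𝔄) →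
      (((Tor (fine (L ^ j.k) j.Mn) × Fin 4) × ι → ℝ) →ₗ[ℝ] ((Tor j.Mn × Fin 4) × ι → ℝ)))
    (Fsc : ∀ j : VecIndexS 3 L, (Fin 4 → Tor (fine (L ^ j.m * L ^ j.k) j.Mn) × Fin 4 → 𝔄) →
      (((Tor j.Mn × Fin 4) × ι → ℝ) →ₗ[ℝ] ((Tor (fine (L ^ j.k) j.Mn) × Fin 4) × ι → ℝ)))
    (Ff : ∀ j : VecIndexS 3 L, (Fin 4 → Tor (fine (L ^ j.m * L ^ j.k) j.Mn) × Fin 4 → 𝔄) →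
      (((Tor (fine (L ^ j.m * L ^ j.k) j.Mn) × Fin 4) × ι → ℝ) →ₗ[ℝ] ((Tor j.Mn × Fin 4) × ι → ℝ)))
    (Fsf : ∀ j : VecIndexS 3 L, (Fin 4 → Tor (fine (L ^ j.m * L ^ j.k) j.Mn) × Fin 4 → 𝔄) →
      (((Tor j.Mn × Fin 4) × ι → ℝ) →ₗ[ℝ] ((Tor (fine (L ^ j.m * L ^ j.k) j.Mn) × Fin 4) × ι → ℝ)))
    (hF : ∀ (j : VecIndexS 3 L) (α₀ : ℝ) A', 0 < α₀ → 2 * (c35 * (j.Msz * α₀)) ≤ 1 → (v1GVecInstance (d := 3) 𝔄 ι L hL j).Bf.Reg335 c35 α₀ A' →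
      HasMaj (BlockNorm.ofBlocks (unitTorusGeoS L j.k j.Mn j.Msz) (liftBlk (blkFine L j.k j.Mn) ι))
        (BlockNorm.ofBlocks (unitTorusGeoS L j.k j.Mn j.Msz) (liftBlk (fun b : Tor j.Mn × Fin 4 => b.1) ι)) (Fc j A') (diagK fun _ => cF * (c35 * j.Msz * α₀)) ∧
      HasMaj (BlockNorm.ofBlocks (unitTorusGeoS L j.k j.Mn j.Msz) (liftBlk (fun b : Tor j.Mn × Fin 4 => b.1) ι))
        (BlockNorm.ofBlocks (unitTorusGeoS L j.k j.Mn j.Msz) (liftBlk (blkFine L j.k j.Mn) ι)) (Fsc j A') (diagK fun _ => cF * (c35 * j.Msz * α₀)) ∧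
      HasMaj (BlockNorm.ofBlocks (unitTorusGeoS L j.k j.Mn j.Msz) (liftBlk (blkFine L j.k j.Mn ∘ kingPrV L j.k j.m j.Mn) ι))
        (BlockNorm.ofBlocks (unitTorusGeoS L j.k j.Mn j.Msz) (liftBlk (fun b : Tor j.Mn × Fin 4 => b.1) ι)) (Ff j A') (diagK fun _ => cF * (c35 * j.Msz * α₀)) ∧
      HasMaj (BlockNorm.ofBlocks (unitTorusGeoS L j.k j.Mn j.Msz) (liftBlk (fun b : Tor j.Mn × Fin 4 => b.1) ι))
        (BlockNorm.ofBlocks (unitTorusGeoS L j.k j.Mn j.Msz) (liftBlk (blkFine L j.k j.Mn ∘ kingPrV L j.k j.m j.Mn) ι)) (Fsf j A')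
        (diagK fun _ => cF * (c35 * j.Msz * α₀)) ∧
      HasMaj (BlockNorm.ofBlocks (unitTorusGeoS L j.k j.Mn j.Msz) (liftBlk (blkFine L j.k j.Mn) ι))
        (BlockNorm.ofBlocks (unitTorusGeoS L j.k j.Mn j.Msz) (liftBlk (fun b : Tor j.Mn × Fin 4 => b.1) ι))
        (idef (pull (liftMap (kingPrV L j.k j.m j.Mn) ι)) LinearMap.id (Ff j A') (Fc j A')) (diagK fun _ => cF * (c35 * j.Msz * α₀) * thetaV L j) ∧
      HasMaj (BlockNorm.ofBlocks (unitTorusGeoS L j.k j.Mn j.Msz) (liftBlk (fun b : Tor j.Mn × Fin 4 => b.1) ι))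
        (BlockNorm.ofBlocks (unitTorusGeoS L j.k j.Mn j.Msz) (liftBlk (blkFine L j.k j.Mn ∘ kingPrV L j.k j.m j.Mn) ι))
        (idef LinearMap.id (pull (liftMap (kingPrV L j.k j.m j.Mn) ι)) (Fsf j A') (Fsc j A')) (diagK fun _ => cF * (c35 * j.Msz * α₀) * thetaV L j))
    (Ws Ws' : ∀ j : VecIndexS 3 L, ((Tor j.Mn × Fin 4) × ι → ℝ) →ₗ[ℝ] ((Tor j.Mn × Fin 4) × ι → ℝ)) {βW δW : ℝ} (hβW : 0 ≤ βW) (hδW : 0 < δW)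
    (hWs : ∀ j, HasMaj (BlockNorm.ofBlocks (unitTorusGeoS L j.k j.Mn j.Msz) (liftBlk (fun b : Tor j.Mn × Fin 4 => b.1) ι))
      (BlockNorm.ofBlocks (unitTorusGeoS L j.k j.Mn j.Msz) (liftBlk (fun b : Tor j.Mn × Fin 4 => b.1) ι)) (Ws j)
      (fun y y' => βW * Real.exp (-(δW * (unitTorusGeoS L j.k j.Mn j.Msz).dist y y'))))
    (hWs' : ∀ j, HasMaj (BlockNorm.ofBlocks (unitTorusGeoS L j.k j.Mn j.Msz) (liftBlk (fun b : Tor j.Mn × Fin 4 => b.1) ι))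
      (BlockNorm.ofBlocks (unitTorusGeoS L j.k j.Mn j.Msz) (liftBlk (fun b : Tor j.Mn × Fin 4 => b.1) ι)) (Ws' j)
      (fun y y' => βW * Real.exp (-(δW * (unitTorusGeoS L j.k j.Mn j.Msz).dist y y'))))
    (hKW : ∀ j, siteForm₀ (liftMap (qbond L j.k j.Mn) ι) (tensorId ι (pieceG L j.Mn (L ^ j.k) j.k (rweight (d := 3) L j.k))) ∘ₗ Ws j = LinearMap.id)
    (hKW' : ∀ j, siteForm₀ (liftMap (qbond L j.k j.Mn) ι ∘ liftMap (kingPrV L j.k j.m j.Mn) ι)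
      (tensorId ι (pieceG L j.Mn (L ^ j.m * L ^ j.k) (j.k + j.m) (rweight (d := 3) L j.k / ((L : ℝ) ^ j.m) ^ 4))) ∘ₗ Ws' j = LinearMap.id) :
    NE2PlusSite 4 p c35 (v1GVecInstance (d := 3) 𝔄 ι L hL) (vWGCVecSiteKernel (d := 3) 𝔄 ι e L a hL Fc Fsc Ff Fsf Ws Ws') :=
  ne2PlusSite_vectorPiece_vWordsGC (d := 3) e a (by norm_num) hL c35 hc35 p hcF Fc Fsc Ff Fsf hF Ws Ws' hβW hδW hWs hWs' hKW hKW'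

/-- **THE PARALLEL-TRANSPORT SPECIES** (`F₂ = Q∘M_{Π_Γ exp(η ad Ā) − 1}`, g4 F9; all six letters by `expF_letters`): the site layer BY NAME with the `U ≡ 1` site
kernels the only displayed binders. [cite: Balaban1985BackgroundPropagators, Thm 3.2 (3.48) p.398 (quantifier template), (3.57)–(3.67) pp.401–403 (shapes, mechanism)] -/
theorem ne2PlusSite_vectorPiece_vWordsExpC (hd : 1 ≤ d) (hL : 1 ≤ L) (c35 : ℝ) (hc35 : 0 < c35) (p : ℝ)
    (Ws Ws' : ∀ j : VecIndexS d L, ((Tor j.Mn × Fin (d + 1)) × ι → ℝ) →ₗ[ℝ] ((Tor j.Mn × Fin (d + 1)) × ι → ℝ)) {βW δW : ℝ} (hβW : 0 ≤ βW) (hδW : 0 < δW)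
    (hWs : ∀ j, HasMaj (BlockNorm.ofBlocks (unitTorusGeoS L j.k j.Mn j.Msz) (liftBlk (fun b : Tor j.Mn × Fin (d + 1) => b.1) ι))
      (BlockNorm.ofBlocks (unitTorusGeoS L j.k j.Mn j.Msz) (liftBlk (fun b : Tor j.Mn × Fin (d + 1) => b.1) ι)) (Ws j)
      (fun y y' => βW * Real.exp (-(δW * (unitTorusGeoS L j.k j.Mn j.Msz).dist y y'))))
    (hWs' : ∀ j, HasMaj (BlockNorm.ofBlocks (unitTorusGeoS L j.k j.Mn j.Msz) (liftBlk (fun b : Tor j.Mn × Fin (d + 1) => b.1) ι))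
      (BlockNorm.ofBlocks (unitTorusGeoS L j.k j.Mn j.Msz) (liftBlk (fun b : Tor j.Mn × Fin (d + 1) => b.1) ι)) (Ws' j)
      (fun y y' => βW * Real.exp (-(δW * (unitTorusGeoS L j.k j.Mn j.Msz).dist y y'))))
    (hKW : ∀ j, siteForm₀ (liftMap (qbond L j.k j.Mn) ι) (tensorId ι (pieceG L j.Mn (L ^ j.k) j.k (rweight (d := d) L j.k))) ∘ₗ Ws j = LinearMap.id)
    (hKW' : ∀ j, siteForm₀ (liftMap (qbond L j.k j.Mn) ι ∘ liftMap (kingPrV L j.k j.m j.Mn) ι)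
      (tensorId ι (pieceG L j.Mn (L ^ j.m * L ^ j.k) (j.k + j.m) (rweight (d := d) L j.k / ((L : ℝ) ^ j.m) ^ (d + 1)))) ∘ₗ Ws' j = LinearMap.id) :
    NE2PlusSite 4 p c35 (v1GVecInstance (d := d) 𝔄 ι L hL)
      (vWGCVecSiteKernel (d := d) 𝔄 ι e L a hL (expFc ι e L) (expFsc ι e L) (expFf ι e L) (expFsf ι e L) Ws Ws') :=
  ne2PlusSite_vectorPiece_vWordsGC (d := d) e a hd hL c35 hc35 p (expCF_nonneg_le (d := d) (basisConst_nonneg e)).1 (expFc ι e L) (expFsc ι e L)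
    (expFf ι e L) (expFsf ι e L) (fun j _ _ hα₀ hsm hreg => expF_letters (d := d) e hL j hc35 hα₀ hsm hreg) Ws Ws' hβW hδW hWs hWs' hKW hKW'

/-- **THE LINEARISED SPECIES** (`F₂ = Q∘M_{ad(ηΣ_Γ Ā)}`, g4 F7; all six letters by `linF_letters`). [cite: Balaban1985BackgroundPropagators, Thm 3.2 (3.48) p.398 (quantifier template), (3.57)–(3.67) pp.401–403 (shapes, mechanism)] -/
theorem ne2PlusSite_vectorPiece_vWordsLinC (hd : 1 ≤ d) (hL : 1 ≤ L) (c35 : ℝ) (hc35 : 0 < c35) (p : ℝ)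
    (Ws Ws' : ∀ j : VecIndexS d L, ((Tor j.Mn × Fin (d + 1)) × ι → ℝ) →ₗ[ℝ] ((Tor j.Mn × Fin (d + 1)) × ι → ℝ)) {βW δW : ℝ} (hβW : 0 ≤ βW) (hδW : 0 < δW)
    (hWs : ∀ j, HasMaj (BlockNorm.ofBlocks (unitTorusGeoS L j.k j.Mn j.Msz) (liftBlk (fun b : Tor j.Mn × Fin (d + 1) => b.1) ι))
      (BlockNorm.ofBlocks (unitTorusGeoS L j.k j.Mn j.Msz) (liftBlk (fun b : Tor j.Mn × Fin (d + 1) => b.1) ι)) (Ws j)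
      (fun y y' => βW * Real.exp (-(δW * (unitTorusGeoS L j.k j.Mn j.Msz).dist y y'))))
    (hWs' : ∀ j, HasMaj (BlockNorm.ofBlocks (unitTorusGeoS L j.k j.Mn j.Msz) (liftBlk (fun b : Tor j.Mn × Fin (d + 1) => b.1) ι))
      (BlockNorm.ofBlocks (unitTorusGeoS L j.k j.Mn j.Msz) (liftBlk (fun b : Tor j.Mn × Fin (d + 1) => b.1) ι)) (Ws' j)
      (fun y y' => βW * Real.exp (-(δW * (unitTorusGeoS L j.k j.Mn j.Msz).dist y y'))))
    (hKW : ∀ j, siteForm₀ (liftMap (qbond L j.k j.Mn) ι) (tensorId ι (pieceG L j.Mn (L ^ j.k) j.k (rweight (d := d) L j.k))) ∘ₗ Ws j = LinearMap.id)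
    (hKW' : ∀ j, siteForm₀ (liftMap (qbond L j.k j.Mn) ι ∘ liftMap (kingPrV L j.k j.m j.Mn) ι)
      (tensorId ι (pieceG L j.Mn (L ^ j.m * L ^ j.k) (j.k + j.m) (rweight (d := d) L j.k / ((L : ℝ) ^ j.m) ^ (d + 1)))) ∘ₗ Ws' j = LinearMap.id) :
    NE2PlusSite 4 p c35 (v1GVecInstance (d := d) 𝔄 ι L hL)
      (vWGCVecSiteKernel (d := d) 𝔄 ι e L a hL (linFc ι e L) (linFsc ι e L) (linFf ι e L) (linFsf ι e L) Ws Ws') :=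
  ne2PlusSite_vectorPiece_vWordsGC (d := d) e a hd hL c35 hc35 p (linCF_nonneg_le (d := d) (basisConst_nonneg e)).1 (linFc ι e L) (linFsc ι e L)
    (linFf ι e L) (linFsf ι e L) (fun j _ _ hα₀ _ hreg => linF_letters (d := d) e hL j hc35 hα₀ hreg) Ws Ws' hβW hδW hWs hWs' hKW hKW'

end Knit

end Summit.QuantumFields.YangMills.BalabanUVNodes.N15.VectorPiece

end
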